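import Literature.Computability.AlgebraicComplexity.RectangularExponentAlpha
import Literature.Computability.AlgebraicComplexity.RectangularExponentAsymptoticRank
import Literature.Computability.AlgebraicComplexity.LickteigBorderSubstitution
import Literature.Computability.AlgebraicComplexity.CoppersmithWinograd1982Crude
import Literature.Barriers.MatrixMultiplication.RectangularBarrierAlphaCW
import Summits.MatrixMultiplication.MatrixMultiplication.Statement
import HarnessLib

/-!
# The lopsided ladder `R̃(⟨n,n,2⟩) = n²`

Solo-informed seat (gen 31), paper §2r.  Everything here is PROVED (def-free).  `t_n = ⟨n,n,2⟩` is
the tensor of `(n × n) · (n × 2)` (two matrix–vector products sharing the matrix), flattening rank `n²`.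

* `asymptoticRank_matMulTensor_eq_rpow_omegaRect_logb`: **`R̃(⟨n,n,m⟩) = n^{ω(1,1,log_n m)}`** for
  all `n ≥ 2`, `m ≥ 1` (the tree had `m = n^c`, `c ∈ ℕ`: `asymptoticRank_matMulTensor_rect`); both
  halves hold for every real exponent `q ≥ 0` (`n^q ≤ m`, resp. `m ≤ n^q`).
  `asymptoticRank_matMulTensor_rotate`: `R̃(⟨k,m,n⟩) = R̃(⟨m,n,k⟩)` (so the ladder is the same for
  `⟨n,2,n⟩`, `⟨2,n,n⟩`).
* The ladder `rung n :⟺ R̃(t_n) ≤ n²` (`⟺ = n²`, `sq_le_asymptoticRank_lopsided`):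
  **`rung n ⟺ log_n 2 ≤ α`** (`asymptoticRank_lopsided_le_sq_iff_logb_le_alpha`); monotone in `n`;
  **`rung 2 ⟺ ω = 2`** (`matrixMultiplication_iff_lopsided_rung_two`: the summit is the bottom
  rung); `rung 3 ⟺ log_3 2 ≤ α`, `rung 4 ⟺ 1/2 ≤ α`, `rung 8 ⟺ 1/3 ≤ α`; **`rung n` over `ℂ` for
  all `n ≥ 9`** from the named fact `vxxz2024_alpha_ge` (`log_9 2 ≤ 8/25 ≤ 0.321334`;
  `asymptoticRank_lopsided_eq_sq_of_alpha_ge`); some rung holds iff `α > 0`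
  (`exists_lopsided_rung_iff_dualExponentAlpha_pos`).
* Barrier placement: no `CW_q`-method certifies rung 3 (`log_3 2 > 5/8`, the Christandl–Le Gall–
  Lysikov–Zuiddam `α`-barrier, tree `alpha_bigCw_le`); rung 4 (`1/2 < 5/8`) is not excluded by it.
* Never attained: `R̲(t_n^{⊠N}) ≥ n^{2N} + 2^N − 1 > n^{2N} = R̃(t_n)^N` on every rung, every
  `N ≥ 1` (Lickteig's increments): `asymptoticRank_pow_lt_algBorderRank_kroneckerPow`.

References: Le Gall 2012 §1 (`α`); Alman–Duan–Vassilevska Williams–Xu–Xu–Zhou 2025 §3.4; Vassilevska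
Williams–Xu–Xu–Zhou 2024 (`α ≥ 0.321334`); Christandl–Le Gall–Lysikov–Zuiddam 2020 §1.3.1;
Lickteig 1984 / Landsberg 2017 Cor. 5.4.1.4; Bläser 2013 Lemma 5.5, Thm. 6.3.
-/

open Filter Asymptotics
open scoped BigOperators

set_option linter.dupNamespace false

namespace Summit.MatrixMultiplication.MatrixMultiplication.Theorems

open Literature.Computability.AlgebraicComplexity
open Literature.Barriers.MatrixMultiplication (asymptoticRank_le_rpow alpha_bigCw_le bigCwTensor
  IsTMethodAlphaBound)

variable (K : Type) [Field K]

/-! ## Symmetry of the asymptotic rank of matrix multiplication tensors -/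

/-- `R̃(⟨k,m,n⟩) = R̃(⟨m,n,k⟩)`: the Kronecker powers are `⟨k^N,m^N,n^N⟩` and `⟨m^N,n^N,k^N⟩`, of
equal rank (Bläser 2013, Lemma 5.5). [cite: Blaser2013, Lemma 5.5] -/
theorem asymptoticRank_matMulTensor_rotate (k m n : ℕ) :
    asymptoticRank (matMulTensor K k m n) = asymptoticRank (matMulTensor K m n k) := by
  unfold asymptoticRank
  congr 1
  funext N
  rw [tensorRank_kroneckerPow_matMulTensor, tensorRank_kroneckerPow_matMulTensor,
    tensorRank_matMulTensor_rotate]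

/-! ## `R̃(⟨n,n,m⟩) = n^{ω(1,1,log_n m)}` — real exponents -/

/-- **`n^{ω(1,1,q)} ≤ R̃(⟨n,n,m⟩)` for `n ≥ 2`, `q ≥ 0`, `n^q ≤ m`**: if `R(⟨n,n,m⟩^{⊠N}) ≤ (R̃+δ)^N`
then (`(n^N)^q ≤ m^N`, `omegaRect_one_one_le_logb`) `ω(1,1,q) ≤ log_{n^N} (R̃+δ)^N = log_n (R̃+δ)`.
[cite: AlmanDuanVassilevskaWilliamsXuXuZhou2025, §3.4] -/
theorem rpow_omegaRect_le_asymptoticRank_matMulTensor_of_rpow_le {n m : ℕ} (hn : 2 ≤ n) {q : ℝ}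
    (hq : 0 ≤ q) (hm : (n : ℝ) ^ q ≤ m) :
    (n : ℝ) ^ omegaRect K 1 1 q ≤ asymptoticRank (matMulTensor K n n m) := by
  have hn1 : (1 : ℝ) < n := by exact_mod_cast hn
  have hn0 : (0 : ℝ) < n := by linarith
  have hm1 : 1 ≤ m := by
    have h1 : (1 : ℝ) ≤ m := (Real.one_le_rpow hn1.le hq).trans hm
    exact_mod_cast h1
  have hr1 : 1 ≤ asymptoticRank (matMulTensor K n n m) :=
    one_le_asymptoticRank_matMulTensor K (by omega) (by omega) hm1
  refine le_of_forall_pos_le_add fun δ hδ => ?_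
  have hrδ : 0 < asymptoticRank (matMulTensor K n n m) + δ := by linarith
  obtain ⟨N, hN1, hN⟩ := exists_tensorRank_kroneckerPow_le_pow K (matMulTensor K n n m) hδ
  rw [tensorRank_kroneckerPow_matMulTensor] at hN
  set ρ := tensorRank (matMulTensor K (n ^ N) (n ^ N) (m ^ N)) with hρ
  have hnN1 : 1 < n ^ N := Nat.one_lt_pow (by omega) (by omega)
  haveI : NeZero (m ^ N) := ⟨pow_ne_zero _ (by omega)⟩
  have hflat : n ^ N * n ^ N ≤ ρ := mul_le_tensorRank_matMulTensor_left K (n ^ N) (n ^ N) (m ^ N)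
  have hρ1 : 1 ≤ ρ := le_trans (Nat.one_le_iff_ne_zero.2 (by positivity)) hflat
  have hA' : (((n ^ N : ℕ) : ℝ)) ^ q ≤ ((m ^ N : ℕ) : ℝ) := by
    push_cast
    rw [← Real.rpow_natCast_mul hn0.le, mul_comm, Real.rpow_mul_natCast hn0.le]
    exact pow_le_pow_left₀ (Real.rpow_nonneg hn0.le q) hm N
  have hω : omegaRect K 1 1 q ≤ Real.logb ((n ^ N : ℕ) : ℝ) ρ :=
    omegaRect_one_one_le_logb K hq hnN1 hA' hρ1 le_rfl
  have hNlog : Real.logb ((n ^ N : ℕ) : ℝ) ρ ≤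
      Real.logb n (asymptoticRank (matMulTensor K n n m) + δ) := by
    have hnN1' : (1 : ℝ) < ((n ^ N : ℕ) : ℝ) := by exact_mod_cast hnN1
    have hρ0 : (0 : ℝ) < ρ := by exact_mod_cast (by omega : 0 < ρ)
    have hN0 : (N : ℝ) ≠ 0 := by exact_mod_cast (by omega : N ≠ 0)
    calc Real.logb ((n ^ N : ℕ) : ℝ) ρ
        ≤ Real.logb ((n ^ N : ℕ) : ℝ) ((asymptoticRank (matMulTensor K n n m) + δ) ^ N) :=
          Real.logb_le_logb_of_le hnN1' hρ0 hN
      _ = Real.logb n (asymptoticRank (matMulTensor K n n m) + δ) := by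
          rw [Real.logb, Real.logb, Nat.cast_pow, Real.log_pow, Real.log_pow,
            mul_div_mul_left _ _ hN0]
  calc (n : ℝ) ^ omegaRect K 1 1 q
      ≤ (n : ℝ) ^ Real.logb n (asymptoticRank (matMulTensor K n n m) + δ) :=
        Real.rpow_le_rpow_of_exponent_le hn1.le (hω.trans hNlog)
    _ = asymptoticRank (matMulTensor K n n m) + δ := Real.rpow_logb hn0 hn1.ne' hrδ

/-- **`R̃(⟨n,n,m⟩) ≤ n^{ω(1,1,q)}` whenever `n ≥ 2`, `m ≥ 1` and `m ≤ n^q`.**  For an admissible `β`,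
`R̃^k ≤ R(⟨n,n,m⟩^{⊠k}) = R(⟨n^k,n^k,m^k⟩) ≤ R(⟨n^k, n^k, ⌈(n^k)^q⌉⟩) ≤ C (n^k)^β` for `k` large
(padding, `m^k ≤ (n^k)^q`); so `R̃ ≤ n^β`. [cite: AlmanDuanVassilevskaWilliamsXuXuZhou2025, §3.4] -/
theorem asymptoticRank_matMulTensor_le_rpow_omegaRect_of_le_rpow {n m : ℕ} (hn : 2 ≤ n)
    (hm1 : 1 ≤ m) {q : ℝ} (hm : (m : ℝ) ≤ (n : ℝ) ^ q) :
    asymptoticRank (matMulTensor K n n m) ≤ (n : ℝ) ^ omegaRect K 1 1 q := by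
  set T := matMulTensor K n n m with hT
  set r := asymptoticRank T with hr
  have hn1 : (1 : ℝ) < n := by exact_mod_cast hn
  have hn0 : (0 : ℝ) < n := by linarith
  have hr1 : 1 ≤ r := one_le_asymptoticRank_matMulTensor K (by omega) (by omega) hm1
  have hr0 : 0 < r := by linarith
  have key : ∀ β ∈ rectAdmissibleExponents K 1 1 q, r ≤ (n : ℝ) ^ β := by
    intro β hβmem
    obtain ⟨C, hC⟩ := isBigO_iff.1 hβmem
    have hnβ0 : 0 < (n : ℝ) ^ β := Real.rpow_pos_of_pos hn0 β
    have hC' : ∀ᶠ k : ℕ in atTop,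
        (tensorRank (kroneckerPow T k) : ℝ) ≤ C * ((n : ℝ) ^ β) ^ k := by
      have ht : Tendsto (fun k : ℕ => n ^ k) atTop atTop :=
        tendsto_pow_atTop_atTop_of_one_lt (by omega : 1 < n)
      filter_upwards [ht.eventually hC] with k hk
      rw [Real.norm_of_nonneg (Nat.cast_nonneg _),
        Real.norm_of_nonneg (Real.rpow_nonneg (Nat.cast_nonneg _) _)] at hk
      have hmk : m ^ k ≤ rectDim (n ^ k) q := by
        have h1 : ((m ^ k : ℕ) : ℝ) ≤ (((n ^ k : ℕ) : ℝ)) ^ q := by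
          push_cast
          rw [← Real.rpow_natCast_mul hn0.le, mul_comm, Real.rpow_mul_natCast hn0.le]
          exact pow_le_pow_left₀ (Nat.cast_nonneg _) hm k
        unfold rectDim
        exact_mod_cast h1.trans (Nat.le_ceil _)
      have e1 : (tensorRank (kroneckerPow T k) : ℝ) ≤ tensorRank (matMulTensor K
          (rectDim (n ^ k) 1) (rectDim (n ^ k) 1) (rectDim (n ^ k) q)) := by
        rw [hT, tensorRank_kroneckerPow_matMulTensor, rectDim_one]
        exact_mod_cast tensorRank_matMulTensor_mono₃ K le_rfl le_rfl hmk
      have e2 : (((n ^ k : ℕ) : ℝ)) ^ β = ((n : ℝ) ^ β) ^ k := by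
        rw [← Real.rpow_mul_natCast hn0.le, mul_comm, Real.rpow_natCast_mul hn0.le]
        push_cast
        rfl
      rw [← e2]
      exact e1.trans hk
    by_contra hlt
    rw [not_le] at hlt
    set ρ := r / (n : ℝ) ^ β with hρ
    have hρ1 : 1 < ρ := (one_lt_div hnβ0).2 hlt
    have hρq : ρ * (n : ℝ) ^ β = r := div_mul_cancel₀ r hnβ0.ne'
    have hev : ∀ᶠ k : ℕ in atTop, C < ρ ^ k :=
      (tendsto_pow_atTop_atTop_of_one_lt hρ1).eventually_gt_atTop C
    obtain ⟨k, hk, hkC, hk1⟩ := (hC'.and (hev.and (eventually_ge_atTop 1))).exists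
    have hrk : r ^ k ≤ (tensorRank (kroneckerPow T k) : ℝ) := by
      have h := asymptoticRank_le_rpow T (by omega : 0 < k)
      rw [← hr] at h
      have hR0 : (0 : ℝ) ≤ tensorRank (kroneckerPow T k) := Nat.cast_nonneg _
      have hk0 : (k : ℝ) ≠ 0 := by exact_mod_cast (by omega : k ≠ 0)
      refine (pow_le_pow_left₀ hr0.le h k).trans_eq ?_
      rw [← Real.rpow_natCast, ← Real.rpow_mul hR0, inv_mul_cancel₀ hk0, Real.rpow_one]
    have hlt' : C * ((n : ℝ) ^ β) ^ k < r ^ k := by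
      calc C * ((n : ℝ) ^ β) ^ k < ρ ^ k * ((n : ℝ) ^ β) ^ k :=
            mul_lt_mul_of_pos_right hkC (pow_pos hnβ0 k)
        _ = r ^ k := by rw [← mul_pow, hρq]
    linarith
  have hlog : Real.logb n r ≤ omegaRect K 1 1 q := by
    show Real.logb n r ≤ sInf (rectAdmissibleExponents K 1 1 q)
    refine le_csInf (rectAdmissibleExponents_nonempty K _ _ _) fun β hβ => ?_
    calc Real.logb n r ≤ Real.logb n ((n : ℝ) ^ β) := Real.logb_le_logb_of_le hn1 hr0 (key β hβ)
      _ = β := Real.logb_rpow hn0 hn1.ne'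
  calc r = (n : ℝ) ^ Real.logb n r := (Real.rpow_logb hn0 hn1.ne' hr0).symm
    _ ≤ (n : ℝ) ^ omegaRect K 1 1 q := Real.rpow_le_rpow_of_exponent_le hn1.le hlog

/-- **`R̃(⟨n,n,m⟩) = n^{ω(1,1,log_n m)}`** for all `n ≥ 2`, `m ≥ 1` (`n^{log_n m} = m`).
[cite: AlmanDuanVassilevskaWilliamsXuXuZhou2025, §3.4] -/
theorem asymptoticRank_matMulTensor_eq_rpow_omegaRect_logb {n m : ℕ} (hn : 2 ≤ n) (hm1 : 1 ≤ m) :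
    asymptoticRank (matMulTensor K n n m) = (n : ℝ) ^ omegaRect K 1 1 (Real.logb n m) := by
  have hn1 : (1 : ℝ) < n := by exact_mod_cast hn
  have hn0 : (0 : ℝ) < n := by linarith
  have hm0 : (0 : ℝ) < m := by exact_mod_cast (by omega : 0 < m)
  have e : (n : ℝ) ^ Real.logb n m = m := Real.rpow_logb hn0 hn1.ne' hm0
  have hq : 0 ≤ Real.logb n m := Real.logb_nonneg hn1 (by exact_mod_cast hm1)
  exact le_antisymm (asymptoticRank_matMulTensor_le_rpow_omegaRect_of_le_rpow K hn hm1 e.symm.le)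
    (rpow_omegaRect_le_asymptoticRank_matMulTensor_of_rpow_le K hn hq e.le)

/-! ## The ladder `R̃(⟨n,n,2⟩) ≤ n²` -/

/-- `R̃(⟨n,n,2⟩) = n^{ω(1, log_n 2, 1)}`. [cite: AlmanDuanVassilevskaWilliamsXuXuZhou2025, §3.4] -/
theorem asymptoticRank_lopsided_eq {n : ℕ} (hn : 2 ≤ n) :
    asymptoticRank (matMulTensor K n n 2) = (n : ℝ) ^ omegaRect K 1 (Real.logb n 2) 1 := by
  rw [omegaRect_one_mid_one]
  exact asymptoticRank_matMulTensor_eq_rpow_omegaRect_logb K hn (by norm_num)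

/-- Flattening: `n² ≤ R̃(⟨n,n,2⟩)` (`ω(1,p,1) ≥ 2`). [cite: Blaser2013, Lemma 7.1 (2)] -/
theorem sq_le_asymptoticRank_lopsided {n : ℕ} (hn : 2 ≤ n) :
    (n : ℝ) ^ 2 ≤ asymptoticRank (matMulTensor K n n 2) := by
  rw [asymptoticRank_lopsided_eq K hn]
  have hn1 : (1 : ℝ) ≤ n := by exact_mod_cast (by omega : 1 ≤ n)
  calc (n : ℝ) ^ 2 = (n : ℝ) ^ (2 : ℝ) := by norm_num
    _ ≤ _ := Real.rpow_le_rpow_of_exponent_le hn1 (two_le_omegaRect_one_mid_one K _)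

/-- **`R̃(⟨n,n,2⟩) ≤ n² ⟺ ω(1, log_n 2, 1) = 2`.** [cite: LeGall2012, §1] -/
theorem asymptoticRank_lopsided_le_sq_iff_omegaRect {n : ℕ} (hn : 2 ≤ n) :
    asymptoticRank (matMulTensor K n n 2) ≤ (n : ℝ) ^ 2 ↔ omegaRect K 1 (Real.logb n 2) 1 = 2 := by
  rw [asymptoticRank_lopsided_eq K hn]
  have hn1 : (1 : ℝ) < n := by exact_mod_cast hn
  have e2 : (n : ℝ) ^ 2 = (n : ℝ) ^ (2 : ℝ) := by norm_num
  rw [e2, Real.rpow_le_rpow_left_iff hn1]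
  exact ⟨fun h => le_antisymm h (two_le_omegaRect_one_mid_one K _), fun h => h.le⟩

/-- **The ladder in terms of the dual exponent: `R̃(⟨n,n,2⟩) ≤ n² ⟺ log_n 2 ≤ α`.**
[cite: LeGall2012, §1] -/
theorem asymptoticRank_lopsided_le_sq_iff_logb_le_alpha {n : ℕ} (hn : 2 ≤ n) :
    asymptoticRank (matMulTensor K n n 2) ≤ (n : ℝ) ^ 2 ↔ Real.logb n 2 ≤ dualExponentAlpha K := by
  rw [asymptoticRank_lopsided_le_sq_iff_omegaRect K hn, omegaRect_eq_two_iff_le_dualExponentAlpha]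

/-- **Monotonicity of the ladder**: `rung n → rung n'` for `2 ≤ n ≤ n'` (`log_{n'} 2 ≤ log_n 2`).
[cite: LeGall2012, §1] -/
theorem lopsided_rung_mono {n n' : ℕ} (hn : 2 ≤ n) (h : n ≤ n')
    (hr : asymptoticRank (matMulTensor K n n 2) ≤ (n : ℝ) ^ 2) :
    asymptoticRank (matMulTensor K n' n' 2) ≤ (n' : ℝ) ^ 2 := by
  rw [asymptoticRank_lopsided_le_sq_iff_logb_le_alpha K hn] at hr
  rw [asymptoticRank_lopsided_le_sq_iff_logb_le_alpha K (hn.trans h)]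
  refine le_trans ?_ hr
  have hn1 : (1 : ℝ) < n := by exact_mod_cast hn
  have hlog : Real.log n ≤ Real.log n' := Real.log_le_log (by positivity) (by exact_mod_cast h)
  unfold Real.logb
  exact div_le_div_of_nonneg_left (Real.log_nonneg (by norm_num)) (Real.log_pos hn1) hlog

/-- **The bottom rung is the summit: `R̃(⟨2,2,2⟩) ≤ 4 ⟺ ω = 2`** (`log_2 2 = 1`, `α = 1 ⟺ ω = 2`).
[cite: VassilevskaWilliamsXuXuZhou2024, §1] -/
theorem asymptoticRank_two_le_four_iff_omega_eq_two :
    asymptoticRank (matMulTensor K 2 2 2) ≤ 4 ↔ omega K = 2 := by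
  have h := asymptoticRank_lopsided_le_sq_iff_logb_le_alpha K (le_refl 2)
  rw [Nat.cast_ofNat, Real.logb_self_eq_one (by norm_num : (1 : ℝ) < 2)] at h
  rw [show (4 : ℝ) = (2 : ℝ) ^ 2 by norm_num, h, ← dualExponentAlpha_eq_one_iff]
  exact ⟨fun h1 => le_antisymm (dualExponentAlpha_le_one K) h1, fun h1 => h1.ge⟩

/-- Over `ℂ`: **`MatrixMultiplication ⟺ R̃(⟨2,2,2⟩) ≤ 4`** — the summit is rung 2 of the ladder.
[cite: Blaser2013, Def. 5.1] -/
theorem matrixMultiplication_iff_lopsided_rung_two :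
    _root_.MatrixMultiplication ↔ asymptoticRank (matMulTensor ℂ 2 2 2) ≤ 4 := by
  rw [MatrixMultiplication_iff, asymptoticRank_two_le_four_iff_omega_eq_two]

/-- `log_{2^k} 2 = 1/k`. [folklore] -/
theorem logb_two_pow_two {k : ℕ} (hk : 1 ≤ k) : Real.logb ((2 : ℝ) ^ k) 2 = 1 / k := by
  have h2 : Real.log 2 ≠ 0 := (Real.log_pos (by norm_num)).ne'
  have hk0 : (k : ℝ) ≠ 0 := by exact_mod_cast (by omega : k ≠ 0)
  rw [Real.logb, Real.log_pow]
  field_simp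

/-- **Rung 8 ⟺ `α ≥ 1/3`** (`R̃(⟨8,8,2⟩) ≤ 64`): the next target for the dual exponent.
[cite: VassilevskaWilliamsXuXuZhou2024, §1] -/
theorem asymptoticRank_882_le_iff : asymptoticRank (matMulTensor K 8 8 2) ≤ 64 ↔
    1 / 3 ≤ dualExponentAlpha K := by
  have h := asymptoticRank_lopsided_le_sq_iff_logb_le_alpha K (by norm_num : 2 ≤ 8)
  rw [show ((8 : ℕ) : ℝ) = (2 : ℝ) ^ 3 by norm_num, logb_two_pow_two (by norm_num)] at h
  norm_num at h
  exact h

/-- **Rung 4 ⟺ `α ≥ 1/2`** (`R̃(⟨4,4,2⟩) ≤ 16`). [cite: VassilevskaWilliamsXuXuZhou2024, §1] -/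
theorem asymptoticRank_442_le_iff : asymptoticRank (matMulTensor K 4 4 2) ≤ 16 ↔
    1 / 2 ≤ dualExponentAlpha K := by
  have h := asymptoticRank_lopsided_le_sq_iff_logb_le_alpha K (by norm_num : 2 ≤ 4)
  rw [show ((4 : ℕ) : ℝ) = (2 : ℝ) ^ 2 by norm_num, logb_two_pow_two (by norm_num)] at h
  norm_num at h
  exact h

/-- **Rung 3 ⟺ `α ≥ log_3 2 = 0.6309…`** (`R̃(⟨3,3,2⟩) ≤ 9`). [cite: VassilevskaWilliamsXuXuZhou2024, §1] -/
theorem asymptoticRank_332_le_iff : asymptoticRank (matMulTensor K 3 3 2) ≤ 9 ↔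
    Real.logb 3 2 ≤ dualExponentAlpha K := by
  have h := asymptoticRank_lopsided_le_sq_iff_logb_le_alpha K (by norm_num : 2 ≤ 3)
  norm_num at h
  exact h

/-- `log_9 2 ≤ 8/25` (`2^25 = 33554432 ≤ 43046721 = 9^8`). [folklore] -/
theorem logb_nine_two_le : Real.logb 9 2 ≤ 8 / 25 := by
  have h9 : 0 < Real.log 9 := Real.log_pos (by norm_num)
  have h : Real.log ((2 : ℝ) ^ 25) ≤ Real.log ((9 : ℝ) ^ 8) :=
    Real.log_le_log (by positivity) (by norm_num)
  rw [Real.log_pow, Real.log_pow] at h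
  push_cast at h
  rw [Real.logb, div_le_iff₀ h9]
  linarith

/-- **Rungs `n ≥ 9` hold over `ℂ`** given `α ≥ 0.321334` (Vassilevska Williams–Xu–Xu–Zhou 2024):
`R̃(⟨n,n,2⟩) = n²` for every `n ≥ 9` (`log_9 2 ≤ 8/25 ≤ 0.321334 ≤ α`, then monotonicity).
[cite: VassilevskaWilliamsXuXuZhou2024, abstract and §1.1] -/
theorem asymptoticRank_lopsided_eq_sq_of_alpha_ge (hα : vxxz2024_alpha_ge) {n : ℕ} (hn : 9 ≤ n) :
    asymptoticRank (matMulTensor ℂ n n 2) = (n : ℝ) ^ 2 := by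
  refine le_antisymm (lopsided_rung_mono ℂ (by norm_num : 2 ≤ 9) hn ?_)
    (sq_le_asymptoticRank_lopsided ℂ (by omega))
  rw [asymptoticRank_lopsided_le_sq_iff_logb_le_alpha ℂ (by norm_num : 2 ≤ 9), Nat.cast_ofNat]
  have hα' : (0.321334 : ℝ) ≤ dualExponentAlpha ℂ := hα
  exact logb_nine_two_le.trans (le_trans (by norm_num) hα')

/-- **The foot of the ladder is `α > 0`**: some rung holds iff the dual exponent is positive
(`log_n 2 → 0`; for `α > 0` every `n ≥ 2^{⌈1/α⌉}` is a rung). [cite: LeGall2012, §1] -/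
theorem exists_lopsided_rung_iff_dualExponentAlpha_pos :
    (∃ n : ℕ, 2 ≤ n ∧ asymptoticRank (matMulTensor K n n 2) ≤ (n : ℝ) ^ 2) ↔
      0 < dualExponentAlpha K := by
  constructor
  · rintro ⟨n, hn, h⟩
    rw [asymptoticRank_lopsided_le_sq_iff_logb_le_alpha K hn] at h
    have hn1 : (1 : ℝ) < n := by exact_mod_cast hn
    exact lt_of_lt_of_le (Real.logb_pos hn1 (by norm_num)) h
  · intro hα
    obtain ⟨k, hk⟩ := exists_nat_ge (1 / dualExponentAlpha K)
    have h1 : (1 : ℝ) ≤ 1 / dualExponentAlpha K := by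
      rw [le_div_iff₀ hα, one_mul]
      exact dualExponentAlpha_le_one K
    have hk1 : 1 ≤ k := by exact_mod_cast h1.trans hk
    have h2k : 2 ≤ 2 ^ k := Nat.one_lt_pow (by omega) (by norm_num)
    refine ⟨2 ^ k, h2k, ?_⟩
    rw [asymptoticRank_lopsided_le_sq_iff_logb_le_alpha K h2k, Nat.cast_pow, Nat.cast_ofNat,
      logb_two_pow_two hk1, one_div_le (by exact_mod_cast (by omega : 0 < k)) hα]
    exact hk

/-! ## Barrier placement: the `CW_q`-methods cannot certify rung 3 -/

/-- `5/8 < log_3 2` (`3^5 = 243 < 256 = 2^8`). [folklore] -/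
theorem five_div_eight_lt_logb_three_two : (5 : ℝ) / 8 < Real.logb 3 2 := by
  have h3 : 0 < Real.log 3 := Real.log_pos (by norm_num)
  have h : Real.log ((3 : ℝ) ^ 5) < Real.log ((2 : ℝ) ^ 8) :=
    Real.log_lt_log (by positivity) (by norm_num)
  rw [Real.log_pow, Real.log_pow] at h
  push_cast at h
  rw [Real.logb, lt_div_iff₀ h3]
  linarith

/-- **No `CW_q`-method (`q ≥ 2`) certifies rung 3**: a `T`-method `α`-bound `p ≥ log_3 2` with
`T = CW_q` contradicts the Christandl–Le Gall–Lysikov–Zuiddam barrier `p ≤ 5/8 < log_3 2`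
(tree: `alpha_bigCw_le`).  Rung 4 (`p = 1/2 < 5/8`) is not excluded by this barrier.
[cite: ChristandlLeGallLysikovZuiddam2020, §1.3.1] -/
theorem not_isTMethodAlphaBound_bigCw_of_logb_three_two_le {q : ℕ} (hq : 2 ≤ q) {p : ℝ}
    (hp : Real.logb 3 2 ≤ p) : ¬ IsTMethodAlphaBound K (bigCwTensor K q) p :=
  fun h => absurd ((hp.trans (alpha_bigCw_le hq h)).trans_lt five_div_eight_lt_logb_three_two)
    (lt_irrefl _)

/-! ## Never attained: border rank of the Kronecker powers -/

/-- `R̲(⟨k,m,n⟩^{⊠L}) = R̲(⟨k^L, m^L, n^L⟩)` (relabelling, as for the rank).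
[cite: Blaser2013, Thm. 6.3] -/
theorem algBorderRank_kroneckerPow_matMulTensor (k m n L : ℕ) :
    algBorderRank (kroneckerPow (matMulTensor K k m n) L) =
      algBorderRank (matMulTensor K (k ^ L) (m ^ L) (n ^ L)) := by
  rw [kroneckerPow_matMulTensor_eq_comp K k m n L]
  exact algBorderRank_reindex
    ((Equiv.arrowProdEquivProdArrow (Fin L) (fun _ => Fin k) (fun _ => Fin n)).trans
      (Equiv.prodCongr finFunctionFinEquiv finFunctionFinEquiv))
    ((Equiv.arrowProdEquivProdArrow (Fin L) (fun _ => Fin k) (fun _ => Fin m)).trans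
      (Equiv.prodCongr finFunctionFinEquiv finFunctionFinEquiv))
    ((Equiv.arrowProdEquivProdArrow (Fin L) (fun _ => Fin m) (fun _ => Fin n)).trans
      (Equiv.prodCongr finFunctionFinEquiv finFunctionFinEquiv))
    (matMulTensor K (k ^ L) (m ^ L) (n ^ L))

/-- **Lickteig iterated: `m n + l ≤ R̲(⟨l+1, m, n⟩)`** (`m, n ≥ 1`). [cite: Lickteig1984, main result] -/
theorem mul_add_le_algBorderRank_matMulTensor (l m n : ℕ) (hm : 1 ≤ m) (hn : 1 ≤ n) :
    m * n + l ≤ algBorderRank (matMulTensor K (l + 1) m n) := by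
  induction l with
  | zero => simpa using mul_le_algBorderRank_matMulTensor_right K 1 m n
  | succ l ih =>
    have h := algBorderRank_matMulTensor_succ_le K (l + 1) m n hm hn
    omega

/-- **`n² + 1 ≤ R̲(⟨n,n,2⟩)`** (`n ≥ 1`; Lickteig 1984, Landsberg 2017 Cor. 5.4.1.4 for `⟨n,2,n⟩`):
the border rank exceeds the flattening rank `n²`. [cite: Lickteig1984, main result] -/
theorem sq_add_one_le_algBorderRank_lopsided {n : ℕ} (hn : 1 ≤ n) :
    n ^ 2 + 1 ≤ algBorderRank (matMulTensor K n n 2) := by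
  rw [← algBorderRank_matMulTensor_rotate K 2 n n, sq]
  exact mul_add_le_algBorderRank_matMulTensor K 1 n n hn hn

/-- **`(n²)^N < R̲(⟨n,n,2⟩^{⊠N})`** for every `N ≥ 1` (`R̲(⟨2^N, n^N, n^N⟩) ≥ n^{2N} + 2^N - 1`).
[cite: Lickteig1984, main result] -/
theorem pow_lt_algBorderRank_kroneckerPow_lopsided {n : ℕ} (hn : 1 ≤ n) {N : ℕ} (hN : 1 ≤ N) :
    (n ^ 2) ^ N < algBorderRank (kroneckerPow (matMulTensor K n n 2) N) := by
  rw [algBorderRank_kroneckerPow_matMulTensor, ← algBorderRank_matMulTensor_rotate K (2 ^ N)]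
  have h2N : 2 ≤ 2 ^ N := Nat.one_lt_pow (by omega) (by norm_num)
  obtain ⟨l, hl⟩ : ∃ l, 2 ^ N = l + 1 := ⟨2 ^ N - 1, by omega⟩
  have hnN : 1 ≤ n ^ N := Nat.one_le_pow _ _ (by omega)
  have h := mul_add_le_algBorderRank_matMulTensor K l (n ^ N) (n ^ N) hnN hnN
  rw [hl]
  have e : (n ^ 2) ^ N = n ^ N * n ^ N := by rw [← pow_mul, mul_comm, pow_mul, sq]
  rw [e]
  omega

/-- **Never attained**: over `ℂ`, for `n ≥ 9` (given `α ≥ 0.321334`), `R̃(t_n)^N = n^{2N}` is strictly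
below the border rank (a fortiori the rank) of `t_n^{⊠N}` for EVERY `N ≥ 1` — the infimum defining
`R̃(t_n)` is attained at no finite level. [cite: VassilevskaWilliamsXuXuZhou2024, §1.1] -/
theorem asymptoticRank_pow_lt_algBorderRank_kroneckerPow (hα : vxxz2024_alpha_ge) {n : ℕ}
    (hn : 9 ≤ n) {N : ℕ} (hN : 1 ≤ N) :
    asymptoticRank (matMulTensor ℂ n n 2) ^ N <
      (algBorderRank (kroneckerPow (matMulTensor ℂ n n 2) N) : ℝ) := by
  rw [asymptoticRank_lopsided_eq_sq_of_alpha_ge hα hn]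
  exact_mod_cast pow_lt_algBorderRank_kroneckerPow_lopsided ℂ (by omega) hN

end Summit.MatrixMultiplication.MatrixMultiplication.Theorems
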